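import Summits.HodgeConjecture.CorCM.Census.QuarticInversionValues

/-!
# The quartic inversion twists, XV: pattern sums, the relations in coordinates, and the normal form of a value vector modulo binomials

COR-CM (cell `pub-hodgecm2`, stage 2 of the Hodge ladder), count-neutral KERNEL COMBINATORICS by the binder seat b23 (gen 44; claim
QUARTIC-INVERSION, HOME/INBOX.md l.12829).  Part XV of the lane `Census/QuarticInversion*`, on top of parts I–XIV, all BY NAME.  Bookkeeping
definitions with bodies (`Pat`, `hv`, `cnt`, `rootPat`, `kOf`, `Φ`, `nf`, `binSpan`) + theorems; no `Prop`-valued definition, no `decide` beyond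
closed identities in `Bool`/`Fin 4`, no certificate, no named fact, no geometry, no `sorry`.  `Interfaces.lean` (C1), every E term, B01,
`Transposition/*`, `PortJoin/*` untouched.
HONEST FRAMING: `HC_CM` is NOT proved, here or anywhere in the tree; nothing here is a period, a count of record or a headline.

CONTENT (`|B|` odd).
* §1 **Pattern sums**: `Σ_{h : h j = false} wA j h s = wUp j s`, `Σ_{η : η a = η b = true} wC η = wLL a b`, `Σ_{η : η 0 = true} (cnt η − 2)·wC η = wD`
  (`cnt η` = number of up entries), and `fnl` is additive in the weight; `wC (!η) = wC η ∘ conj₄`.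
* §2 **The relations in coordinates** for `v ∈ hodge₄`, with `kOf j v = fnl (wUp j 0) v` and `C_η = fnl (wC η) v`:
  `fnl (wUp j s) v = kOf j v`; `kOf a v + kOf b v + Σ_{η a = η b = true} C_η = 0`; `Σ_j kOf j v = Σ_{η 0 = true} (cnt η − 2)·C_η`; `C_{!η} = −C_η`.
* §3 **The normal form** `nf v = Φ (kOf · v) (C_· v)`, `Φ k C = Σ_j k_j·D_j + Σ_η C_η·e_η` (`D_j` the indicator of the root pattern of coordinate `j`),
  and THE NORMAL FORM LEMMA: for `v ∈ hodge₄`, `Avec v − nf v ∈ binSpan` (the span of all slot binomials) (`Avec_sub_nf_mem`).  Hence a submodule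
  containing every slot binomial and `nf v` contains `Avec v` (`Avec_mem_of_nf_mem`).  All [folklore].

## References
* [Pohlmann1968] H. Pohlmann, Algebraic cycles on abelian varieties of complex multiplication type, Ann. of Math. 88 (1968), Thm 1.
-/

namespace Summit.HodgeConjecture.CorCM.Census.QuarticInversion

open Finset
open Summit.HodgeConjecture.CorCM.Census.OddSliceFacesModel

noncomputable section

variable (A : Type) [AddCommGroup A] [Fintype A] [DecidableEq A]

/-! ## §1 Pattern sums -/

/-- The normalised patterns of the atom coordinate `j` (`h j = false`). [folklore] -/
def Pat (j : Fin 4) : Finset (Fin 4 → Bool) := univ.filter fun h => h j = false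

/-- The half vector of a label. [folklore] -/
def hv (Θ : Ty₄ A) : Fin 4 → Bool := fun n => half A (coord A n Θ)

/-- The number of up entries of a pattern. [folklore] -/
def cnt (η : Fin 4 → Bool) : ℤ := ∑ n, (if η n = false then (1 : ℤ) else 0)

omit [AddCommGroup A] [DecidableEq A] in
/-- `wMatch j h Θ = [h = hv Θ off j]`. [folklore] -/
theorem wMatch_eq_ind₁ (j : Fin 4) (h : Fin 4 → Bool) (Θ : Ty₄ A) : wMatch A j h Θ = ind₁ j h (hv A Θ) := rfl

omit [AddCommGroup A] [DecidableEq A] in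
/-- **Exactly one normalised pattern matches**: `Σ_{h ∈ Pat j} wMatch j h Θ = 1`. [folklore] -/
theorem sum_wMatch (j : Fin 4) (Θ : Ty₄ A) : (∑ h ∈ Pat j, wMatch A j h Θ) = 1 := by
  set h₀ : Fin 4 → Bool := Function.update (hv A Θ) j false with hh₀
  have hmem : h₀ ∈ Pat j := by rw [Pat, mem_filter, hh₀, Function.update_self]; exact ⟨mem_univ _, rfl⟩
  rw [Finset.sum_eq_single_of_mem h₀ hmem]
  · unfold wMatch
    rw [if_pos]
    intro i hi
    rw [hh₀, Function.update_of_ne hi]; rfl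
  · intro h hP hne
    unfold wMatch
    rw [if_neg]
    intro H
    apply hne
    funext n
    by_cases hn : n = j
    · rw [hn, hh₀, Function.update_self]; exact (mem_filter.mp hP).2
    · rw [hh₀, Function.update_of_ne hn, ← H n hn]; rfl

omit [AddCommGroup A] [DecidableEq A] in
/-- **`Σ_{h ∈ Pat j} wA j h s = wUp j s`.** [folklore] -/
theorem sum_wA (j : Fin 4) (s : A) (Θ : Ty₄ A) : (∑ h ∈ Pat j, wA A j h s Θ) = wUp A j s Θ := by
  unfold wA
  rw [← Finset.sum_mul, sum_wMatch, one_mul]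

omit [AddCommGroup A] [DecidableEq A] in
/-- `wC η Θ = [hv Θ = η]`. [folklore] -/
theorem wC_eq_ite (η : Fin 4 → Bool) (Θ : Ty₄ A) : wC A η Θ = if hv A Θ = η then 1 else 0 := by
  unfold wC
  have key : (∀ i, half A (coord A i Θ) = η i) ↔ hv A Θ = η := funext_iff.symm
  simp only [key]

omit [AddCommGroup A] [DecidableEq A] in
/-- **`Σ_{η a = η b = true} wC η = wLL a b`.** [folklore] -/
theorem sum_wC_eq_wLL (a b : Fin 4) (Θ : Ty₄ A) :
    (∑ η ∈ univ.filter (fun η : Fin 4 → Bool => η a = true ∧ η b = true), wC A η Θ) = wLL A a b Θ := by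
  simp only [wC_eq_ite, Finset.sum_ite_eq, mem_filter, mem_univ, true_and]
  rfl

omit [AddCommGroup A] [DecidableEq A] in
/-- `nUp Θ = cnt (hv Θ)`. [folklore] -/
theorem nUp_eq_cnt (Θ : Ty₄ A) : nUp A Θ = cnt (hv A Θ) := rfl

omit [AddCommGroup A] [DecidableEq A] in
/-- **`Σ_{η 0 = true} (cnt η − 2)·wC η = wD`.** [folklore] -/
theorem sum_wC_eq_wD (Θ : Ty₄ A) :
    (∑ η ∈ univ.filter (fun η : Fin 4 → Bool => η 0 = true), (cnt η - 2) * wC A η Θ) = wD A Θ := by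
  simp only [wC_eq_ite, mul_ite, mul_one, mul_zero, Finset.sum_ite_eq, mem_filter, mem_univ, true_and]
  unfold wD
  rw [nUp_eq_cnt]
  rfl

omit [AddCommGroup A] in
/-- `fnl` is additive in the weight over a finite sum. [folklore] -/
theorem fnl_sum_weight {ι : Type} (S : Finset ι) (w : ι → Ty₄ A → ℤ) (v : Ty₄ A → ℤ) :
    fnl A (fun Θ => ∑ i ∈ S, w i Θ) v = ∑ i ∈ S, fnl A (w i) v := by
  simp only [fnl_apply]
  rw [Finset.sum_comm]
  refine Finset.sum_congr rfl fun Θ _ => ?_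
  rw [← Finset.sum_sub_distrib, Finset.mul_sum]

omit [AddCommGroup A] in
/-- `fnl` is homogeneous in the weight. [folklore] -/
theorem fnl_smul_weight (c : ℤ) (w v : Ty₄ A → ℤ) : fnl A (fun Θ => c * w Θ) v = c * fnl A w v := by
  simp only [fnl_apply, Finset.mul_sum]
  refine Finset.sum_congr rfl fun Θ _ => ?_
  ring

omit [AddCommGroup A] in
/-- **`Σ_{h ∈ Pat j} fnl (wA j h s) v = fnl (wUp j s) v`.** [folklore] -/
theorem sum_fnl_wA (j : Fin 4) (s : A) (v : Ty₄ A → ℤ) : (∑ h ∈ Pat j, fnl A (wA A j h s) v) = fnl A (wUp A j s) v := by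
  have hw : (fun Θ => ∑ h ∈ Pat j, wA A j h s Θ) = wUp A j s := funext fun Θ => sum_wA A j s Θ
  rw [← fnl_sum_weight, hw]

omit [AddCommGroup A] in
/-- **`Σ_{η a = η b = true} fnl (wC η) v = fnl (wLL a b) v`.** [folklore] -/
theorem sum_fnl_wC_eq_fnl_wLL (a b : Fin 4) (v : Ty₄ A → ℤ) :
    (∑ η ∈ univ.filter (fun η : Fin 4 → Bool => η a = true ∧ η b = true), fnl A (wC A η) v) = fnl A (wLL A a b) v := by
  have hw : (fun Θ => ∑ η ∈ univ.filter (fun η : Fin 4 → Bool => η a = true ∧ η b = true), wC A η Θ) = wLL A a b :=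
    funext fun Θ => sum_wC_eq_wLL A a b Θ
  rw [← fnl_sum_weight, hw]

omit [AddCommGroup A] in
/-- **`Σ_{η 0 = true} (cnt η − 2)·fnl (wC η) v = fnl wD v`.** [folklore] -/
theorem sum_fnl_wC_eq_fnl_wD (v : Ty₄ A → ℤ) :
    (∑ η ∈ univ.filter (fun η : Fin 4 → Bool => η 0 = true), (cnt η - 2) * fnl A (wC A η) v) = fnl A (wD A) v := by
  have hw : (fun Θ => ∑ η ∈ univ.filter (fun η : Fin 4 → Bool => η 0 = true), (cnt η - 2) * wC A η Θ) = wD A :=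
    funext fun Θ => sum_wC_eq_wD A Θ
  simp only [← fnl_smul_weight]
  rw [← fnl_sum_weight, hw]

omit [AddCommGroup A] in
/-- **The constant functionals are pair-odd in the pattern**: `fnl (wC !η) v = − fnl (wC η) v`. [folklore] -/
theorem fnl_wC_not (hA : Odd (Fintype.card A)) (η : Fin 4 → Bool) (v : Ty₄ A → ℤ) :
    fnl A (wC A (fun n => !η n)) v = -fnl A (wC A η) v := by
  have hw : wC A (fun n => !η n) = (wC A η ∘ conj₄ A) := funext fun Θ => (wC_conj₄ A hA η Θ).symm
  rw [hw, fnl_comp_conj₄]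

omit [AddCommGroup A] [DecidableEq A] in
/-- The atom weight does not read the pattern at its own coordinate. [folklore] -/
theorem wA_congr {j : Fin 4} {η η' : Fin 4 → Bool} (h : ∀ n, n ≠ j → η n = η' n) (s : A) : wA A j η s = wA A j η' s := by
  funext Θ
  unfold wA wMatch
  have key : (∀ i, i ≠ j → half A (coord A i Θ) = η i) ↔ (∀ i, i ≠ j → half A (coord A i Θ) = η' i) := by
    constructor
    · intro H i hi; rw [H i hi, h i hi]
    · intro H i hi; rw [H i hi, ← h i hi]
  simp only [key]

/-! ## §2 The relations in coordinates -/

/-- **The column value** `kOf j v = fnl (wUp j 0) v`. [folklore] -/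
def kOf (j : Fin 4) (v : Ty₄ A → ℤ) : ℤ := fnl A (wUp A j 0) v

/-- The column relation in coordinates. [folklore] -/
theorem fnl_wUp_eq_kOf (hA : Odd (Fintype.card A)) {v : Ty₄ A → ℤ} (hv : v ∈ hodge₄ A) (j : Fin 4) (s : A) :
    fnl A (wUp A j s) v = kOf A j v :=
  fnl_wUp_eq A hA hv j s 0

/-- **R1–R3 (and their companions)**: `kOf a v + kOf b v + Σ_{η a = η b = true} fnl (wC η) v = 0`. [folklore] -/
theorem rel_pair (hA : Odd (Fintype.card A)) {v : Ty₄ A → ℤ} (hv : v ∈ hodge₄ A) (a b : Fin 4) :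
    kOf A a v + kOf A b v + (∑ η ∈ univ.filter (fun η : Fin 4 → Bool => η a = true ∧ η b = true), fnl A (wC A η) v) = 0 := by
  rw [sum_fnl_wC_eq_fnl_wLL]
  exact fnl_pair_rel A hA hv a b 0 0

/-- **R4**: `Σ_j kOf j v = Σ_{η 0 = true} (cnt η − 2)·fnl (wC η) v`. [folklore] -/
theorem rel_diag (hA : Odd (Fintype.card A)) {v : Ty₄ A → ℤ} (hv : v ∈ hodge₄ A) :
    kOf A 0 v + kOf A 1 v + kOf A 2 v + kOf A 3 v =
      (∑ η ∈ univ.filter (fun η : Fin 4 → Bool => η 0 = true), (cnt η - 2) * fnl A (wC A η) v) := by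
  rw [sum_fnl_wC_eq_fnl_wD]
  exact fnl_diag_rel A hA hv (fun _ => 0)

/-! ## §3 The normal form modulo binomials -/

/-- The root pattern (all up). [folklore] -/
def rootPat : Fin 4 → Bool := fun _ => false

/-- **The coordinate embedding** `Φ k C = Σ_j k_j·D_j + Σ_η C_η·e_η`. [folklore] -/
def Φ (k : Fin 4 → ℤ) (C : (Fin 4 → Bool) → ℤ) : Idx A → ℤ
  | Sum.inl ⟨j, η, _⟩ => k j * ind₁ j rootPat η
  | Sum.inr η => C η

omit [AddCommGroup A] [Fintype A] [DecidableEq A] in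
/-- `Φ` is additive. [folklore] -/
theorem Φ_add (k k' : Fin 4 → ℤ) (C C' : (Fin 4 → Bool) → ℤ) : Φ A (k + k') (C + C') = Φ A k C + Φ A k' C' := by
  funext i; rcases i with ⟨j, η, s⟩ | η
  · show (k j + k' j) * _ = k j * _ + k' j * _; ring
  · rfl

omit [AddCommGroup A] [Fintype A] [DecidableEq A] in
/-- `Φ` is homogeneous. [folklore] -/
theorem Φ_smul (c : ℤ) (k : Fin 4 → ℤ) (C : (Fin 4 → Bool) → ℤ) : Φ A (c • k) (c • C) = c • Φ A k C := by
  funext i; rcases i with ⟨j, η, s⟩ | η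
  · show (c * k j) * _ = c * (k j * _); ring
  · rfl

/-- **The normal form** of the value vector of `v`. [folklore] -/
def nf (v : Ty₄ A → ℤ) : Idx A → ℤ := Φ A (fun j => kOf A j v) (fun η => fnl A (wC A η) v)

/-- **The span of all slot binomials.** [folklore] -/
def binSpan : Submodule ℤ (Idx A → ℤ) := Submodule.span ℤ {x | ∃ j h h' u, x = binVec A j h h' u}

omit [AddCommGroup A] [Fintype A] in
/-- Binomials lie in `binSpan`. [folklore] -/
theorem binVec_mem_binSpan (j : Fin 4) (h h' : Fin 4 → Bool) (u : A) : binVec A j h h' u ∈ binSpan A :=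
  Submodule.subset_span ⟨j, h, h', u, rfl⟩

omit [AddCommGroup A] [Fintype A] [DecidableEq A] in
/-- The matching normalised pattern: `ind₁ j h η = [h = update η j false]` for `h ∈ Pat j`. [folklore] -/
theorem ind₁_eq_ite_of_mem {j : Fin 4} {h : Fin 4 → Bool} (hh : h ∈ Pat j) (η : Fin 4 → Bool) :
    ind₁ j h η = if h = Function.update η j false then 1 else 0 := by
  unfold ind₁
  have key : (∀ n, n ≠ j → η n = h n) ↔ h = Function.update η j false := by
    constructor
    · intro H; funext n
      by_cases hn : n = j
      · rw [hn, Function.update_self]; exact (mem_filter.mp hh).2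
      · rw [Function.update_of_ne hn, H n hn]
    · intro H n hn; rw [H, Function.update_of_ne hn]
  simp only [key]

/-- **THE NORMAL FORM LEMMA**: for a Hodge vector, `Avec v − nf v` is an explicit combination of slot binomials. [folklore] -/
theorem Avec_sub_nf_eq (hA : Odd (Fintype.card A)) {v : Ty₄ A → ℤ} (hv : v ∈ hodge₄ A) :
    Avec A v - nf A v = ∑ j : Fin 4, ∑ s : A, ∑ h ∈ Pat j, fnl A (wA A j h s) v • binVec A j h rootPat s := by
  funext i
  rcases i with ⟨j', η, s'⟩ | η
  · rw [Pi.sub_apply, Avec_inl]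
    simp only [Finset.sum_apply, Pi.smul_apply, smul_eq_mul, binVec_inl]
    rw [Finset.sum_eq_single j']
    · rw [Finset.sum_eq_single s']
      · simp only [true_and, if_true, mul_sub, Finset.sum_sub_distrib, ← Finset.sum_mul, sum_fnl_wA, fnl_wUp_eq_kOf A hA hv]
        have hmem : Function.update η j' false ∈ Pat j' := by
          rw [Pat, mem_filter, Function.update_self]; exact ⟨mem_univ _, rfl⟩
        have h1 : ∑ h ∈ Pat j', fnl A (wA A j' h s') v * ind₁ j' h η = fnl A (wA A j' η s') v := by
          rw [Finset.sum_eq_single_of_mem _ hmem]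
          · rw [ind₁_eq_ite_of_mem hmem, if_pos rfl, mul_one,
              wA_congr A (η := Function.update η j' false) (η' := η) (fun n hn => Function.update_of_ne hn _ _)]
          · intro h hh hne; rw [ind₁_eq_ite_of_mem hh, if_neg hne, mul_zero]
        rw [h1]
        rfl
      · intro s _ hs; simp [Ne.symm hs]
      · intro h; exact absurd (mem_univ _) h
    · intro j _ hj; simp [Ne.symm hj]
    · intro h; exact absurd (mem_univ _) h
  · rw [Pi.sub_apply, Avec_inr]
    simp only [Finset.sum_apply, Pi.smul_apply, smul_eq_mul, binVec_inr, mul_zero, Finset.sum_const_zero]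
    show fnl A (wC A η) v - fnl A (wC A η) v = 0
    rw [sub_self]

/-- **`Avec v − nf v ∈ binSpan`** for `v ∈ hodge₄`. [folklore] -/
theorem Avec_sub_nf_mem (hA : Odd (Fintype.card A)) {v : Ty₄ A → ℤ} (hv : v ∈ hodge₄ A) : Avec A v - nf A v ∈ binSpan A := by
  rw [Avec_sub_nf_eq A hA hv]
  refine Submodule.sum_mem _ fun j _ => Submodule.sum_mem _ fun s _ => Submodule.sum_mem _ fun h _ => ?_
  exact Submodule.smul_mem _ _ (binVec_mem_binSpan A j h rootPat s)

/-- **A submodule containing every slot binomial and the normal form of `v` contains `Avec v`** (`v ∈ hodge₄`). [folklore] -/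
theorem Avec_mem_of_nf_mem (hA : Odd (Fintype.card A)) {M : Submodule ℤ (Idx A → ℤ)} (hbin : ∀ j h h' u, binVec A j h h' u ∈ M)
    {v : Ty₄ A → ℤ} (hv : v ∈ hodge₄ A) (hnf : nf A v ∈ M) : Avec A v ∈ M := by
  have hle : binSpan A ≤ M := Submodule.span_le.mpr (by rintro _ ⟨j, h, h', u, rfl⟩; exact hbin j h h' u)
  have := M.add_mem (hle (Avec_sub_nf_mem A hA hv)) hnf
  rwa [sub_add_cancel] at this

end

end Summit.HodgeConjecture.CorCM.Census.QuarticInversion
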